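import Mathlib
import HarnessLib

/-!
# Rankin's method for smooth numbers

Trunk `AntSieve`.  A PROVED classical inequality ("Rankin's method"; Montgomery–Vaughan,
*Multiplicative Number Theory I*, §7.1, (7.17)): for `0 < σ` and all `N, k`,

  `Ψ(N, k) = #{1 ≤ n ≤ N : p ∣ n ⇒ p < k} ≤ N^σ ∏_{p < k} (1 − p^{−σ})⁻¹`,

since `1 ≤ (N/n)^σ` for every `n` counted and the full sum `∑_{p ∣ n ⇒ p < k} n^{−σ}` is the Euler
product.  Stated for Mathlib's `Nat.smoothNumbersUpTo N k` (prime factors `< k`; Montgomery–Vaughan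
use `p ≤ y`) via Mathlib's Euler product over smooth numbers
(`EulerProduct.summable_and_hasSum_smoothNumbers_prod_primesBelow_geometric`).  It is the
smooth-number input for Siegel–Walfisz bounds for sifted Möbius sequences in the Bombieri–
Friedlander–Iwaniec programme (`Literature.NumberTheory.Sieve.BombieriFriedlanderIwaniecDyadic`).

## References

* H. L. Montgomery, R. C. Vaughan, *Multiplicative Number Theory I*, CUP 2007, §7.1 (7.17).
  [MontgomeryVaughan2007]
* R. A. Rankin, *The difference between consecutive prime numbers*, J. London Math. Soc. 13 (1938),
  242–247.
-/

open Finset Real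

namespace Literature.NumberTheory.Sieve

/-- The completely multiplicative function `n ↦ n^{−σ}` on `ℕ` (real values), as a monoid
homomorphism `ℕ →* ℝ`. [folklore] -/
noncomputable def rpowNegHom (σ : ℝ) : ℕ →* ℝ where
  toFun n := (n : ℝ) ^ (-σ)
  map_one' := by simp
  map_mul' m n := by
    push_cast
    exact Real.mul_rpow (Nat.cast_nonneg m) (Nat.cast_nonneg n)

/-- Unfolding lemma for `rpowNegHom`. [folklore] -/
@[simp] theorem rpowNegHom_apply (σ : ℝ) (n : ℕ) : rpowNegHom σ n = (n : ℝ) ^ (-σ) := rfl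

/-- **Rankin's method** (Montgomery–Vaughan (7.17)): for `σ > 0`,
`#{n ≤ N : n ≥ 1, p ∣ n ⇒ p < k} ≤ N^σ ∏_{p < k} (1 − p^{−σ})⁻¹`.  PROVED: each counted `n` has
`1 ≤ (N/n)^σ = N^σ n^{−σ}`, and `∑_{n k-smooth} n^{−σ} = ∏_{p<k} (1 − p^{−σ})⁻¹` (Euler product,
Mathlib). [cite: MontgomeryVaughan2007, §7.1 (7.17)] -/
theorem card_smoothNumbersUpTo_le_rankin (N k : ℕ) {σ : ℝ} (hσ : 0 < σ) :
    ((Nat.smoothNumbersUpTo N k).card : ℝ) ≤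
      (N : ℝ) ^ σ * ∏ p ∈ k.primesBelow, (1 - (p : ℝ) ^ (-σ))⁻¹ := by
  set f : ℕ →* ℝ := rpowNegHom σ with hf
  -- the Euler product over `k`-smooth numbers
  have hlt : ∀ {p : ℕ}, p.Prime → ‖f p‖ < 1 := by
    intro p hp
    rw [hf, rpowNegHom_apply, Real.norm_eq_abs, abs_of_nonneg (by positivity)]
    exact Real.rpow_lt_one_of_one_lt_of_neg (by exact_mod_cast hp.one_lt) (by linarith)
  obtain ⟨-, hsum⟩ := EulerProduct.summable_and_hasSum_smoothNumbers_prod_primesBelow_geometric hlt k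
  have hprod : ∏ p ∈ k.primesBelow, (1 - f p)⁻¹ = ∏ p ∈ k.primesBelow, (1 - (p : ℝ) ^ (-σ))⁻¹ := by
    simp [hf]
  -- Step 1: `card ≤ ∑_{n ∈ S} (N/n)^σ = N^σ ∑_{n ∈ S} n^{-σ}`
  set S := Nat.smoothNumbersUpTo N k with hS
  have hmem : ∀ n ∈ S, 1 ≤ n ∧ n ≤ N ∧ n ∈ Nat.smoothNumbers k := by
    intro n hn
    obtain ⟨hnN, hsm⟩ := Nat.mem_smoothNumbersUpTo.1 hn
    exact ⟨Nat.pos_of_ne_zero hsm.1, hnN, hsm⟩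
  have h1 : (S.card : ℝ) ≤ ∑ n ∈ S, (N : ℝ) ^ σ * (n : ℝ) ^ (-σ) := by
    rw [Finset.card_eq_sum_ones, Nat.cast_sum]
    refine Finset.sum_le_sum fun n hn => ?_
    obtain ⟨hn1, hnN, -⟩ := hmem n hn
    have hn0 : (0 : ℝ) < n := by exact_mod_cast hn1
    rw [Nat.cast_one, Real.rpow_neg hn0.le, ← div_eq_mul_inv, ← Real.div_rpow (Nat.cast_nonneg N) hn0.le]
    exact Real.one_le_rpow ((one_le_div hn0).2 (by exact_mod_cast hnN)) hσ.le
  refine h1.trans ?_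
  rw [← Finset.mul_sum]
  refine mul_le_mul_of_nonneg_left ?_ (by positivity)
  -- Step 2: the finite sum over `S` is bounded by the full Euler product
  rw [← hprod]
  have hsub : ∑ n ∈ S, (n : ℝ) ^ (-σ) =
      ∑ m ∈ S.subtype (· ∈ Nat.smoothNumbers k), f (m : ℕ) := by
    rw [Finset.sum_subtype_eq_sum_filter]
    rw [Finset.filter_true_of_mem fun n hn => (hmem n hn).2.2]
    simp [hf]
  rw [hsub]
  refine sum_le_hasSum _ (fun m _ => ?_) hsum
  simp only [hf, rpowNegHom_apply]
  positivity

end Literature.NumberTheory.Sieve
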